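import Summits.HodgeConjecture.CorCM.HypLiu418.A3Liu418EtaleItems
import Literature.NumberTheory.Automorphic.Liu2021.AppendixC.Prop413DataOfTower
import HarnessLib

/-!
# Line `a3-liu418`, stub P — the THETA HALF: `BettiThetaDecomposition` from [Liu 2021, Prop. 4.13] AS PRINTED

Cell `hodgecm-mathlib`, fan A, rung A-III (binder `hLiu418` → `HypLiu418`); Summits lane `CorCM/HypLiu418/`; seat A-p06 (director NEXT
2026-08-28T02:33:49Z, RULING (P) 02:22:42Z: `stub_bettiThetaModel_of_hyp413 : Hyp413 → AlbaneseH1Comparison → StubBettiThetaModel`).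
The registered stub `stub_bettiThetaModel` of the crux skeleton `A-plan/lines/a3-liu418.lean` (v3 sha16 1b96ade3f8b6b529) asks for a
complex Betti tower module `(H, rhoB)` PINNED to the Albanese levels and carrying the decomposition
`BettiThetaDecomposition U H rhoB` (tree decl, `A3Liu418EtaleItems`, p598646) over ALL labelled admissible oscillator triples of the
face's uniform family `U`.  This file proves the generic bookkeeping that turns the LITERAL binder currency of `Hyp413` —
`Prop413AsPrinted (U.prop413Data H)` ([Liu2021] Prop. 4.13 exactly as printed for the μ-uniform carriers `U` and a tower module
`H`, `AppendixC/Prop413DataOfTower.lean`: `HB _ := H`, `rhoB _ := Representation.ofModule' H`) — into that decomposition: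

* `bettiThetaDecomposition_of_prop413AsPrinted : Prop413AsPrinted (U.prop413Data H) → 3 ≤ n → BettiThetaDecomposition U H
  (Representation.ofModule' H)` — re-index the printed isomorphism at any one `τ'` along the identification of the two index
  types (the same six data `(μ, hμ, weight one, ε, admissible, χ)`; the tower module of `U.prop413Data H` does not depend on `τ'`).

With the tree's `AdapterMuConjLegs.prop413AsPrinted_muConj` (the `μ ↦ μᶜ` relabelling, p-landed) and the index of record
(`exists_indexOfRecord_fst_eq`, `repAt_mk_self`) this is the `Hyp413` half of stub P at the pin `H := TowerCarrier.Tower … V`; the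
PINNING half (canonical-model Betti levels ↔ the universe tower, plus B3-01 `AlbaneseH1Comparison`) is separate.  Theorems only;
nothing of [Liu2021] is asserted; HC_CM is proved only modulo the 7 printed citations until rung 0 closes.

## References
* [Liu2021] Y. Liu, *Fourier–Jacobi cycles and arithmetic relative trace formula* (2021), Def. 4.11–4.12, Prop. 4.13 (FJcycle.tex
  l. 2110–2131), Thm. 4.18 proof l. 2254–2257.
-/

set_option autoImplicit false

noncomputable section

namespace Summit.HodgeConjecture.CorCM.Lines.A3Liu418

open scoped DirectSum
open NumberField
open Literature.NumberTheory.Automorphic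
open Literature.NumberTheory.Automorphic.Liu2021 Literature.NumberTheory.Automorphic.Liu2021.AppendixC

variable {F₀ E₀ : Type} [Field F₀] [NumberField F₀] [IsTotallyReal F₀] [Field E₀] [NumberField E₀] [Algebra F₀ E₀]
  [IsTotallyComplex E₀] [Algebra.IsQuadraticExtension F₀ E₀] [IsCMField E₀]
variable {P5 : PropC5Data F₀ E₀} {isotropicAt : ℕ → Prop} {C : Sec42Data P5 isotropicAt}

/-- **[Prop 4.13] AS PRINTED ⟹ the theta decomposition of the tower module** (Thm 4.18 proof l. 2254–2257 «by Proposition 4.13 …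
`H¹_{B,τ'}(A_∞, ℂ) ≃ ⊕ ω(μ, ε, χ)`»): if `Prop413AsPrinted (U.prop413Data H)` and `n ≥ 3`, then `(H, Representation.ofModule' H)`
decomposes `𝔾(𝔸_F^∞)`-equivariantly as `⊕_{(μ,ε,χ)} ω(μ, ε, χ)` over all labelled admissible triples of `U`
(`BettiThetaDecomposition`): the printed isomorphism at any one embedding `τ'`, re-indexed along the identification of index types.
[cite: Liu2021, Prop. 4.13 (FJcycle.tex l. 2110–2131); Thm. 4.18 proof l. 2254–2257] -/
theorem bettiThetaDecomposition_of_prop413AsPrinted (U : UniformOmega C) (H : Type) [AddCommGroup H] [Module ℂ H]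
    [Module (MonoidAlgebra ℂ C.G) H] [IsScalarTower ℂ (MonoidAlgebra ℂ C.G) H]
    (h413 : Prop413AsPrinted (U.prop413Data H)) (hn : 3 ≤ P5.n) (τ' : E₀ →+* ℂ) :
    BettiThetaDecomposition U H (Representation.ofModule' (k := ℂ) (G := C.G) H) := by
  classical
  obtain ⟨Φ, hΦ⟩ := h413 hn τ'
  -- the two index types of Prop. 4.13's direct sum coincide («μ of weight one, ε μ-admissible», l. 2118 / Def. 4.12):
  -- an admissible triple of `U.prop413Data H` IS a labelled admissible triple of `U` — the same six data, repackaged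
  let e : (U.prop413Data H).AdmTriple ≃ AdmTripleAll U :=
    { toFun := fun t => ⟨t.1.μ, t.1.isConjugateSymplectic, t.2.1, t.1.ε, t.2.2, t.1.χ⟩
      invFun := fun s => ⟨⟨s.μ, s.hμ, s.ε, s.χ⟩, s.hw, s.adm⟩
      left_inv := fun _ => rfl
      right_inv := fun _ => rfl }
  refine ⟨Φ ≪≫ₗ DirectSum.lequivCongrLeft ℂ e, fun g x t => ?_⟩
  -- the re-indexed sum, componentwise: `(L y) t = y (e⁻¹ t)`
  have key : ∀ (y : ⨁ s : (U.prop413Data H).AdmTriple, (U.prop413Data H).omegaAt s) (t : AdmTripleAll U),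
      (DirectSum.lequivCongrLeft ℂ e y) t = y (e.symm t) := fun y t => DirectSum.lequivCongrLeft_apply _ _ _ _
  have h1 : (DirectSum.lequivCongrLeft ℂ e (Φ (((U.prop413Data H).rhoB τ') g x))) t =
      Φ (((U.prop413Data H).rhoB τ') g x) (e.symm t) := key _ _
  have h2 : (DirectSum.lequivCongrLeft ℂ e (Φ x)) t = Φ x (e.symm t) := key _ _
  exact h1.trans ((hΦ g x (e.symm t)).trans (congrArg ((((U.prop413Data H).rhoAt (e.symm t)) g)) h2).symm)

end Summit.HodgeConjecture.CorCM.Lines.A3Liu418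

end
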